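import Mathlib
import Summits.ResolutionOfSingularities.ResolutionOfSingularities.Theorems.ToricLadder
import Summits.ResolutionOfSingularities.ResolutionOfSingularities.Theorems.DefectlessLadder
import Summits.ResolutionOfSingularities.ResolutionOfSingularities.Theorems.ValuativeLuAlphaPTorsorAPTorsion
import HarnessLib

/-!
# PerturbationDominance — decomp-res node «PerturbationLadder» (lens-1), generation 20, PART VIII (§30), first half:
MONOMIAL DOMINATION and FIRST-ORDER TRANSFER (tree companion `PerturbationDensity`, file 1 of 2)

WRITER PROVENANCE (decomp-res-writer-1 g8): lines 1–326 of `HOME/decomp-res-lens-1/g20/tree/PerturbationDensity.lean`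
(sha256 6d5a6373…; node `g20/PerturbationLadder.lean` c0f73e29, WRITER.md d15638b0) VERBATIM, landed under
CRITIC-LEDGER row 153 (CLEARED, lens-1 g20 MAP +2: Lemma B hypothesis-free; the W-cut); writer changes = the 532-line
companion split in two before `exists_pow_mul_lt_of_rankOne` (400-line cap), the file-level linter option
dropped, and the copy `valuation_algebraMap_eq_one` replaced by the landed `PfaffLine.ap_valuation_algebraMap_eq_one`
(gate dedup.landed, p796313).  Valuative side (supports stmt-ResolutionOfSingularities-0641, helper); namespace
`…Theorems.PerturbationDensity` in BOTH files (declaration names exactly as in the node).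

ORIGINAL COMPANION HEADER.
# PerturbationDensity — TREE-FACING COMPANION of the gen-20 node `PerturbationLadder`, PART VIII (§30)

Lemma B of the gen-17 inhabitant certificates, hypothesis-free, in kernel: first-order perturbation of a monomial
chart preserves density (`isDenseOver_of_firstOrderApprox`, `isDenseOver_of_monomialChange`).  This file is the
node's `section Perturbation` VERBATIM, re-pointed at the landed tree declarations `ToricLadder.IsDenseOver`,
`ToricLadder.IsValIndepOver` (by `open`) and `DefectlessLadder.valuation_le_pow_of_rankOne`; pure additions, no
tree statement touched.  Suggested landing: `Theorems/PerturbationDensity.lean` (writer-1), namespace below.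
-/

open scoped BigOperators

namespace Summit.ResolutionOfSingularities.ResolutionOfSingularities.Theorems.PerturbationDensity

open Summit.ResolutionOfSingularities.ResolutionOfSingularities.Theorems.ToricLadder
open Summit.ResolutionOfSingularities.ResolutionOfSingularities.Theorems.DefectlessLadder

/-! # PART VIII — LEMMA B hypothesis-free: PERTURBATION DENSITY (gen 20)

## 30. First-order perturbation of a monomial chart preserves density

SETTING (hypothesis-free: an arbitrary valued field). `k ⊆ K` fields, `O` a valuation subring of `K` with
`k ⊆ O` (`hk`), `v := O.valuation`; `IsDenseOver O F₀` (§8, the predicate of `SepDenseBelow`) says that every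
`x ∈ K` is approximated from the intermediate field `F₀` to within every value `v w`, `w ≠ 0`.

THEOREM (Lemma B of the g17 certificates, paper there). Let `y : Fin n → K` have INJECTIVE MONOMIAL VALUES
(`a ↦ ∏ v(yᵢ)^{aᵢ}` injective on `ℕ`-exponent vectors — automatic when the `v(yᵢ)` are `ℤ`-independent modulo the
values of a subfield, `monomialValues_injective_of_isValIndepOver`). Suppose `v` has rank one and `K` is dense over
`k(y)`. (1) `isDenseOver_of_firstOrderApprox`: if an intermediate field `L` contains `wᵢ` with
`v(yᵢ - wᵢ) < v(yᵢ)` for every `i`, then `K` is dense over `L`. (2) `isDenseOver_of_monomialChange`: if the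
residues of `O` are `k`-rational, then `K` is dense over `k(u)` for every tuple `u` of non-zero elements such that
each `v(yᵢ)` is the value of a Laurent monomial in `u`.

PROOF (all kernel below). (a) MONOMIAL DOMINATION `valuation_aeval_dominant`: for `p ≠ 0` the terms
`c_a yᵃ` of `p(y)` have pairwise distinct values (`v(c_a) = 1`, injectivity), so by the ultrametric strict
maximum `v(p(y)) = max_a v(yᵃ)` over the support and `p(y) ≠ 0`. (b) FIRST-ORDER TRANSFER: with
`δ := maxᵢ v(yᵢ - wᵢ)/v(yᵢ) < 1`, products and monomials satisfy `v(yᵃ - wᵃ) ≤ δ v(yᵃ)`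
(`valuation_prod_sub_prod_le`, telescoping), hence `v(p(y) - p(w)) ≤ δ · max_a v(yᵃ) = δ v(p(y))` by (a)
(`valuation_aeval_sub_aeval_le`) — this is the only place where injectivity is used, and it is essential (R35) —
so `v(p(w)) = v(p(y))` and, by the quotient rule, `v(b - b(w)) ≤ δ v(b)` for every `b = p(y)/q(y) ∈ k(y)`, with
`b(w) := p(w)/q(w) ∈ L` (`exists_firstOrder_transfer`). (c) ITERATION `exists_approx_iterate`: to approximate
`x` within `v w`, take `b ∈ k(y)` with `v(x - b) < v w`; if `v(x - b) ≥ v x` then `a := 0` already works; else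
`v b = v x`, replace `b` by `b(w) ∈ L` at the cost `v(x - b(w)) ≤ max (v(x - b)) (δ v x)` and recurse on `x - b(w)`:
after `m` steps the error is `< v w` or `≤ δ^m v x`. (d) RANK ONE (`exists_pow_mul_lt_of_rankOne`, from the
in-file `valuation_le_pow_of_rankOne`): `δ^m v x < v w` for some `m`. (2) follows from (1) with
`wᵢ := cᵢ · uᴬ⁽ⁱ⁾`, `cᵢ ∈ k` the residue of `yᵢ / uᴬ⁽ⁱ⁾` (`v(yᵢ/uᴬ⁽ⁱ⁾ - cᵢ) < 1`).
No completion, no Neumann series, no separability / characteristic / perfectness hypothesis is used; the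
paper's isometry `σ̂ : 𝔸_y → 𝔸_y` is (b), its surjectivity is (c)+(d). -/

section Perturbation

variable {k K : Type} [Field k] [Field K] [Algebra k K]

/-- Ultrametric STRICT MAXIMUM over a finset whose terms have pairwise distinct values: the sum
has the value of its dominant term, which dominates every term. [folklore] -/
theorem exists_valuation_sum_eq_of_injOn {ι : Type*} (O : ValuationSubring K) (s : Finset ι)
    (f : ι → K) (hs : s.Nonempty)
    (hinj : ∀ i ∈ s, ∀ j ∈ s, O.valuation (f i) = O.valuation (f j) → i = j) :
    ∃ i₀ ∈ s, O.valuation (∑ i ∈ s, f i) = O.valuation (f i₀) ∧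
      ∀ i ∈ s, O.valuation (f i) ≤ O.valuation (f i₀) := by
  classical
  obtain ⟨i₀, hi₀, hmax⟩ := s.exists_max_image (fun i => O.valuation (f i)) hs
  refine ⟨i₀, hi₀, ?_, hmax⟩
  refine Valuation.map_sum_eq_of_lt _ hi₀ fun i hi => ?_
  rw [Finset.mem_sdiff, Finset.mem_singleton] at hi
  exact lt_of_le_of_ne (hmax i hi.1) (fun h => hi.2 (hinj i hi.1 i₀ hi₀ h))

-- `valuation_algebraMap_eq_one` (non-zero ground constants have value `1`) is the landed
-- `PfaffLine.ap_valuation_algebraMap_eq_one` (module `ValuativeLuAlphaPTorsorAPTorsion`), cited by name below.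

/-- The MONOMIAL VALUE of an exponent vector `a` on the tuple `y`. [folklore] -/
theorem valuation_monomial_eq (O : ValuationSubring K) {n : ℕ} (y : Fin n → K) (a : Fin n →₀ ℕ) :
    O.valuation (a.prod fun i e => y i ^ e) = a.prod fun i e => O.valuation (y i) ^ e := by
  rw [map_finsuppProd]
  simp only [map_pow]

/-- A tuple with INJECTIVE MONOMIAL VALUES (`a ↦ v(yᵃ)` injective on `ℕ`-exponents — e.g. values
`ℤ`-independent, `monomialValues_injective_of_isValIndepOver`) has no zero coordinate. [folklore] -/
theorem ne_zero_of_monomialValues_injective (O : ValuationSubring K) {n : ℕ} {y : Fin n → K}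
    (hM : Function.Injective fun a : Fin n →₀ ℕ => a.prod fun i e => O.valuation (y i) ^ e)
    (i : Fin n) : y i ≠ 0 := by
  intro h0
  have h12 : (Finsupp.single i 1 : Fin n →₀ ℕ) = Finsupp.single i 2 := by
    apply hM
    dsimp only
    rw [Finsupp.prod_single_index (by simp), Finsupp.prod_single_index (by simp), h0, map_zero]
    simp
  have := Finsupp.single_injective i h12
  omega

/-- **MONOMIAL DOMINATION.** If `k ⊆ O` and the monomial values of `y` are injective, a non-zero
polynomial expression `p(y)` has the value of its dominant monomial, which dominates every monomial
of `p` (no cancellation between distinct monomials — Gauss–Bourbaki, KK05 Cor. 2.2, in the form this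
node needs). [folklore] -/
theorem valuation_aeval_dominant (O : ValuationSubring K) (hk : ∀ c : k, algebraMap k K c ∈ O)
    {n : ℕ} {y : Fin n → K}
    (hM : Function.Injective fun a : Fin n →₀ ℕ => a.prod fun i e => O.valuation (y i) ^ e)
    (p : MvPolynomial (Fin n) k) (hp : p ≠ 0) :
    ∃ a₀ ∈ p.support,
      O.valuation (MvPolynomial.aeval y p) = (a₀.prod fun i e => O.valuation (y i) ^ e) ∧
      ∀ a ∈ p.support, (a.prod fun i e => O.valuation (y i) ^ e) ≤
        O.valuation (MvPolynomial.aeval y p) := by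
  classical
  set f : (Fin n →₀ ℕ) → K := fun a => algebraMap k K (p.coeff a) * a.prod fun i e => y i ^ e
    with hf
  have hsum : MvPolynomial.aeval y p = ∑ a ∈ p.support, f a := by
    conv_lhs => rw [p.as_sum]
    rw [map_sum]
    refine Finset.sum_congr rfl fun a _ => ?_
    rw [MvPolynomial.aeval_monomial]
  have hval : ∀ a ∈ p.support, O.valuation (f a) = a.prod fun i e => O.valuation (y i) ^ e := by
    intro a ha
    rw [hf]
    dsimp only
    rw [map_mul, PfaffLine.ap_valuation_algebraMap_eq_one O hk (MvPolynomial.mem_support_iff.mp ha), one_mul,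
      valuation_monomial_eq]
  have hs : p.support.Nonempty := MvPolynomial.support_nonempty.mpr hp
  have hinj : ∀ a ∈ p.support, ∀ b ∈ p.support, O.valuation (f a) = O.valuation (f b) → a = b := by
    intro a ha b hb hab
    rw [hval a ha, hval b hb] at hab
    exact hM hab
  obtain ⟨a₀, ha₀, heq, hdom⟩ := exists_valuation_sum_eq_of_injOn O p.support f hs hinj
  refine ⟨a₀, ha₀, ?_, ?_⟩
  · rw [hsum, heq, hval a₀ ha₀]
  · intro a ha
    rw [hsum, heq, ← hval a ha]
    exact hdom a ha

/-- With injective monomial values, a non-zero polynomial expression in `y` is non-zero. [folklore] -/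
theorem aeval_ne_zero_of_monomialValues_injective (O : ValuationSubring K)
    (hk : ∀ c : k, algebraMap k K c ∈ O) {n : ℕ} {y : Fin n → K}
    (hM : Function.Injective fun a : Fin n →₀ ℕ => a.prod fun i e => O.valuation (y i) ^ e)
    (p : MvPolynomial (Fin n) k) (hp : p ≠ 0) : MvPolynomial.aeval y p ≠ 0 := by
  obtain ⟨a₀, -, heq, -⟩ := valuation_aeval_dominant O hk hM p hp
  rw [← (O.valuation).ne_zero_iff, heq, ← valuation_monomial_eq, Valuation.ne_zero_iff]
  rw [Finsupp.prod]
  exact Finset.prod_ne_zero_iff.mpr fun i _ => pow_ne_zero _ (ne_zero_of_monomialValues_injective O hM i)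

/-- **PERTURBATION OF PRODUCTS.** If each factor is known to first order (`v(fᵢ - gᵢ) ≤ δ·v(fᵢ)`,
`δ ≤ 1`), so is the product. [folklore] -/
theorem valuation_prod_sub_prod_le {ι : Type*} (O : ValuationSubring K) (s : Finset ι) (f g : ι → K)
    {δ : O.ValueGroup} (hδ : δ ≤ 1)
    (h : ∀ i ∈ s, O.valuation (f i - g i) ≤ δ * O.valuation (f i)) :
    O.valuation (∏ i ∈ s, f i - ∏ i ∈ s, g i) ≤ δ * O.valuation (∏ i ∈ s, f i) := by
  classical
  induction s using Finset.induction_on with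
  | empty => simp
  | @insert b s hb ih =>
    have h' : ∀ i ∈ s, O.valuation (f i - g i) ≤ δ * O.valuation (f i) :=
      fun i hi => h i (Finset.mem_insert_of_mem hi)
    have hih := ih h'
    have hbb := h b (Finset.mem_insert_self b s)
    rw [Finset.prod_insert hb, Finset.prod_insert hb]
    set F := ∏ i ∈ s, f i
    set G := ∏ i ∈ s, g i
    have hG : O.valuation G ≤ O.valuation F := by
      have hFG : O.valuation (F - G) ≤ O.valuation F :=
        hih.trans (by simpa using mul_le_mul_left hδ (O.valuation F))
      have : G = F - (F - G) := by ring
      rw [this]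
      exact (Valuation.map_sub _ _ _).trans (max_le le_rfl hFG)
    have hsplit : f b * F - g b * G = f b * (F - G) + (f b - g b) * G := by ring
    rw [hsplit, map_mul]
    apply Valuation.map_add_le
    · rw [map_mul]
      calc O.valuation (f b) * O.valuation (F - G) ≤ O.valuation (f b) * (δ * O.valuation F) :=
            mul_le_mul_right hih _
        _ = δ * (O.valuation (f b) * O.valuation F) := by rw [mul_left_comm]
    · rw [map_mul]
      calc O.valuation (f b - g b) * O.valuation G ≤ (δ * O.valuation (f b)) * O.valuation F :=
            mul_le_mul' hbb hG
        _ = δ * (O.valuation (f b) * O.valuation F) := by rw [mul_assoc]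

/-- Powers are known to first order when the base is. [folklore] -/
theorem valuation_pow_sub_pow_le (O : ValuationSubring K) {y w : K} {δ : O.ValueGroup} (hδ : δ ≤ 1)
    (h : O.valuation (y - w) ≤ δ * O.valuation y) (e : ℕ) :
    O.valuation (y ^ e - w ^ e) ≤ δ * O.valuation (y ^ e) := by
  have := valuation_prod_sub_prod_le O (Finset.range e) (fun _ => y) (fun _ => w) hδ (fun _ _ => h)
  simpa [Finset.prod_const, Finset.card_range] using this

/-- Monomials are known to first order when the coordinates are. [folklore] -/
theorem valuation_monomial_sub_le (O : ValuationSubring K) {n : ℕ} {y w : Fin n → K}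
    {δ : O.ValueGroup} (hδ : δ ≤ 1) (hw : ∀ i, O.valuation (y i - w i) ≤ δ * O.valuation (y i))
    (a : Fin n →₀ ℕ) :
    O.valuation ((a.prod fun i e => y i ^ e) - a.prod fun i e => w i ^ e) ≤
      δ * O.valuation (a.prod fun i e => y i ^ e) := by
  unfold Finsupp.prod
  exact valuation_prod_sub_prod_le O a.support (fun i => y i ^ a i) (fun i => w i ^ a i) hδ
    (fun i _ => valuation_pow_sub_pow_le O hδ (hw i) (a i))

/-- **PERTURBATION OF POLYNOMIAL EXPRESSIONS.** Substituting first-order approximations `w` of an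
injective-monomial-value tuple `y` changes a polynomial expression by at most the factor `δ` —
BECAUSE distinct monomials cannot cancel (`valuation_aeval_dominant`). [folklore] -/
theorem valuation_aeval_sub_aeval_le (O : ValuationSubring K) (hk : ∀ c : k, algebraMap k K c ∈ O)
    {n : ℕ} {y w : Fin n → K}
    (hM : Function.Injective fun a : Fin n →₀ ℕ => a.prod fun i e => O.valuation (y i) ^ e)
    {δ : O.ValueGroup} (hδ : δ ≤ 1) (hw : ∀ i, O.valuation (y i - w i) ≤ δ * O.valuation (y i))
    (p : MvPolynomial (Fin n) k) :
    O.valuation (MvPolynomial.aeval y p - MvPolynomial.aeval w p) ≤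
      δ * O.valuation (MvPolynomial.aeval y p) := by
  classical
  by_cases hp : p = 0
  · simp [hp]
  obtain ⟨a₀, ha₀, heq, hdom⟩ := valuation_aeval_dominant O hk hM p hp
  have hdiff : MvPolynomial.aeval y p - MvPolynomial.aeval w p =
      ∑ a ∈ p.support, algebraMap k K (p.coeff a) *
        ((a.prod fun i e => y i ^ e) - a.prod fun i e => w i ^ e) := by
    conv_lhs => rw [p.as_sum]
    rw [map_sum, map_sum, ← Finset.sum_sub_distrib]
    refine Finset.sum_congr rfl fun a _ => ?_
    rw [MvPolynomial.aeval_monomial, MvPolynomial.aeval_monomial, mul_sub]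
  rw [hdiff]
  apply Valuation.map_sum_le
  intro a ha
  rw [map_mul]
  have hc : O.valuation (algebraMap k K (p.coeff a)) ≤ 1 := (O.valuation_le_one_iff _).mpr (hk _)
  calc O.valuation (algebraMap k K (p.coeff a)) *
        O.valuation ((a.prod fun i e => y i ^ e) - a.prod fun i e => w i ^ e)
      ≤ 1 * (δ * O.valuation (a.prod fun i e => y i ^ e)) :=
        mul_le_mul' hc (valuation_monomial_sub_le O hδ hw a)
    _ = δ * (a.prod fun i e => O.valuation (y i) ^ e) := by rw [one_mul, valuation_monomial_eq]
    _ ≤ δ * O.valuation (MvPolynomial.aeval y p) := mul_le_mul_right (hdom a ha) _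

/-- Under a STRICT first-order perturbation (`δ < 1`) polynomial expressions keep their value.
[folklore] -/
theorem valuation_aeval_perturb_eq (O : ValuationSubring K) (hk : ∀ c : k, algebraMap k K c ∈ O)
    {n : ℕ} {y w : Fin n → K}
    (hM : Function.Injective fun a : Fin n →₀ ℕ => a.prod fun i e => O.valuation (y i) ^ e)
    {δ : O.ValueGroup} (hδ : δ < 1) (hw : ∀ i, O.valuation (y i - w i) ≤ δ * O.valuation (y i))
    (p : MvPolynomial (Fin n) k) :
    O.valuation (MvPolynomial.aeval w p) = O.valuation (MvPolynomial.aeval y p) := by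
  by_cases hp : p = 0
  · simp [hp]
  have hne : MvPolynomial.aeval y p ≠ 0 := aeval_ne_zero_of_monomialValues_injective O hk hM p hp
  apply Valuation.map_eq_of_sub_lt
  rw [Valuation.map_sub_swap]
  calc O.valuation (MvPolynomial.aeval y p - MvPolynomial.aeval w p)
      ≤ δ * O.valuation (MvPolynomial.aeval y p) := valuation_aeval_sub_aeval_le O hk hM hδ.le hw p
    _ < 1 * O.valuation (MvPolynomial.aeval y p) :=
        mul_lt_mul_of_pos_right hδ (zero_lt_iff.mpr ((Valuation.ne_zero_iff _).mpr hne))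
    _ = O.valuation (MvPolynomial.aeval y p) := one_mul _

/-- **FIRST-ORDER TRANSFER FOR THE RATIONAL FUNCTION FIELD `k(y)`.** Every element `b` of `k(y)` is
known to first order from `L` as soon as the coordinates `y i` are: with `w i ∈ L`,
`v(y i - w i) ≤ δ v(y i)`, `δ < 1`, the element `b' := b(w) ∈ L` satisfies `v(b - b') ≤ δ v(b)`
(polynomials: `valuation_aeval_sub_aeval_le`; quotients by the quotient rule).  The isometric
substitution `σ : y ↦ w` of the paper Lemma B, without completions. [folklore] -/
theorem exists_firstOrder_transfer (O : ValuationSubring K) (hk : ∀ c : k, algebraMap k K c ∈ O)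
    {n : ℕ} {y w : Fin n → K}
    (hM : Function.Injective fun a : Fin n →₀ ℕ => a.prod fun i e => O.valuation (y i) ^ e)
    {δ : O.ValueGroup} (hδ : δ < 1) (hw : ∀ i, O.valuation (y i - w i) ≤ δ * O.valuation (y i))
    (L : IntermediateField k K) (hwL : ∀ i, w i ∈ L) {b : K}
    (hb : b ∈ IntermediateField.adjoin k (Set.range y)) :
    ∃ b' ∈ L, O.valuation (b - b') ≤ δ * O.valuation b := by
  classical
  obtain ⟨r, s, rfl⟩ := (IntermediateField.mem_adjoin_range_iff k y b).mp hb
  -- images of polynomial expressions in `w` lie in `L`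
  have hsub : Algebra.adjoin k (Set.range w) ≤ L.toSubalgebra :=
    Algebra.adjoin_le (by rintro _ ⟨i, rfl⟩; exact hwL i)
  have hmemL : ∀ q : MvPolynomial (Fin n) k, MvPolynomial.aeval w q ∈ L := by
    intro q
    have hq : MvPolynomial.aeval w q ∈ Algebra.adjoin k (Set.range w) := by
      rw [Algebra.adjoin_range_eq_range_aeval]; exact ⟨q, rfl⟩
    exact hsub hq
  by_cases hs : s = 0
  · exact ⟨0, L.zero_mem, by simp [hs]⟩
  by_cases hr : r = 0
  · exact ⟨0, L.zero_mem, by simp [hr]⟩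
  set R := MvPolynomial.aeval y r
  set S := MvPolynomial.aeval y s
  set R' := MvPolynomial.aeval w r
  set S' := MvPolynomial.aeval w s
  have hS : S ≠ 0 := aeval_ne_zero_of_monomialValues_injective O hk hM s hs
  have hvS' : O.valuation S' = O.valuation S := valuation_aeval_perturb_eq O hk hM hδ hw s
  have hvS : O.valuation S ≠ 0 := (Valuation.ne_zero_iff _).mpr hS
  have hS' : S' ≠ 0 := by rw [← (O.valuation).ne_zero_iff, hvS']; exact hvS
  refine ⟨R' / S', L.div_mem (hmemL r) (hmemL s), ?_⟩
  have hRR : O.valuation (R - R') ≤ δ * O.valuation R := valuation_aeval_sub_aeval_le O hk hM hδ.le hw r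
  have hSS : O.valuation (S - S') ≤ δ * O.valuation S := valuation_aeval_sub_aeval_le O hk hM hδ.le hw s
  -- the quotient rule
  have hnum : O.valuation (R * S' - S * R') ≤ δ * (O.valuation R * O.valuation S) := by
    have hsplit : R * S' - S * R' = R * (S' - S) + S * (R - R') := by ring
    rw [hsplit]
    apply Valuation.map_add_le
    · rw [map_mul, Valuation.map_sub_swap]
      calc O.valuation R * O.valuation (S - S') ≤ O.valuation R * (δ * O.valuation S) :=
            mul_le_mul_right hSS _
        _ = δ * (O.valuation R * O.valuation S) := by rw [mul_left_comm]
    · rw [map_mul]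
      calc O.valuation S * O.valuation (R - R') ≤ O.valuation S * (δ * O.valuation R) :=
            mul_le_mul_right hRR _
        _ = δ * (O.valuation R * O.valuation S) := by
            rw [mul_left_comm, mul_comm (O.valuation S) (O.valuation R)]
  have hkey : (R / S - R' / S') * (S * S') = R * S' - S * R' := by
    field_simp
  have hmul : O.valuation ((R / S - R' / S') * (S * S')) = O.valuation (R * S' - S * R') := by
    rw [hkey]
  rw [map_mul, map_mul, hvS'] at hmul
  have hb : O.valuation (R / S) * O.valuation S = O.valuation R := by
    rw [← map_mul, div_mul_cancel₀ R hS]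
  -- cancel `v S * v S ≠ 0`
  have hSS0 : O.valuation S * O.valuation S ≠ 0 := mul_ne_zero hvS hvS
  refine le_of_mul_le_mul_right ?_ (zero_lt_iff.mpr hSS0)
  rw [hmul, mul_assoc, ← mul_assoc (O.valuation (R / S)), hb]
  exact hnum

end Perturbation

end Summit.ResolutionOfSingularities.ResolutionOfSingularities.Theorems.PerturbationDensity
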